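import Summits.HodgeConjecture.HodgeConjecture.Theorems.HCCMUnconditionalH21OfLevelStructure
import Literature.NumberTheory.ComplexMultiplication.ShimuraTaniyamaOfMainTheoremAbelianScheme
import HarnessLib

/-!
# The Casselman binder body with «good reduction» read as in SERRE–TATE §1 (an abelian-scheme model over `𝓞_{k,v}`) — PROVED from
# the main theorem of CM with NO inertia hypothesis, NO converse of Néron–Ogg–Šafarevič and NO bridge r₀

Topic: summit `HodgeConjecture`, sub-problem `HodgeConjecture`, route `HCCMUnconditional`, crux `H21` (item stmt-HodgeConjecture-24834;
`H21 := PrintedCitationHypotheses.Hyp21 := shimura1998_thm21_4_casselman` by `rfl`).  PROVER FILE (cell hodgecm-mathlib, D-0151 release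
track, ladder HODGECM-MATHLIB rung 0; seat A-p08 g5; `--supports stmt-HodgeConjecture-24834`): sorry-free, axioms ⊆ trio, THEOREMS ONLY,
namespace `Summit.HodgeConjecture.CorCM.Hyp21`.  Sibling of B-p14's `HCCMUnconditionalH21OfInertiaFlat` (edition E-19.11♭1).

WHAT.  The floor of record (v7) carries, on the `h21` leg, the bridge **r₀** «a smooth proper `𝓞_{K,v}`-model of (the variety of) an
abelian variety carries an abelian-scheme structure» (`exists_isAbelianSchemeModel_of_hasGoodReductionAt`; [BLRNeronModels1990] 1.2/8 +
Weil's theorem on birational group laws; READ-FIRST A-p14 08:4xZ: L/XL).  r₀ is load-bearing for ONE reason (A-p01 J-h12 08:11:49Z, director g3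
BATCH 79): the binder `shimura1998_thm21_4_casselman` (and [Liu2021] Def. 4.5, `Def45.IsCMCharacterMuAlgHecke`) key their Frobenius clause
on the tree's SCHEME-level `HasGoodReductionAt A₀.X A₀.dim v` («a smooth proper model of the bare variety»), whereas the tree's PROVED
Serre–Tate chain (B-p07 Lemma 2, B-p09 inertia, `IsAbelianSchemeModel.exists_primesAbove_forall_inertia_tateRep_eq_one`) starts from an
abelian-scheme model — [SerreTate1968] §1's own DEFINITION of good reduction.  This file is the kernel certificate that, with the Frobenius
clause keyed on Serre–Tate's notion (`∃ (𝒜 : SchemeOver 𝓞_{k,v}) [GrpObj 𝒜], IsAbelianSchemeModel A₀ v 𝒜`, the conclusion shape of the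
cofinite spreading theorem ★ `AbelianVariety.exists_finite_forall_exists_isAbelianSchemeModel` and of r₀ itself), the WHOLE ♭ binder body
is a theorem of {row II-1 `shimura1998_thm18_6`} alone, equivalently of {S7a `levelStructure`, S5b ★}:

* `casselmanST_of_thm18_6 (h186)` — B-p14's `casselmanFlat_of_thm18_6_of_inertia` body over A-p10's `casselmanCore_of_thm18_6` and the
  Serre–Tate-currency II-5 theorem `shimuraTaniyama_heckeCharactersST_of_thm18_6` (A-p08, `ShimuraTaniyamaOfMainTheoremAbelianScheme`);
  the two Frobenius descriptions are compared at the cofinitely many ABELIAN-SCHEME places (spreading out the GROUP law,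
  ★ `exists_finite_forall_exists_isAbelianSchemeModel`, [Milne1986AbelianVarieties] Rem. 20.9) that are unramified for `χ`;
* `casselmanST_of_levelStructure (h7a) (h5b)` — the same at `h186 := thm18_6_of_levelStructure h7a h5b` (the floor's reading);
* `casselmanST_of_casselmanFlat` — SANITY (the re-keying is a WEAKENING of the binder body): the ♭ body with the scheme-level antecedent
  implies the ST body (an abelian-scheme model is a smooth proper model, `hasGoodReductionAt_of_exists_isAbelianSchemeModel`).

READING / BOOKS.  Nothing here names the binder: its `def` still carries `HasGoodReductionAt`; re-keying it (and Def. 4.5) on Serre–Tate's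
notion is an END-HYP RETYPE in the sense of director g3 BATCH 114 — `Hyp21` WEAKER, `HypLiu418` formally STRONGER (Def. 4.5 quantifies the
same clause hypothesis-side; the two notions agree in truth exactly by r₀) — and needs a director line; these bytes elaborate unchanged
before and after such an edition and are its producer.  HC_CM is proved only modulo the 7 printed citations until rung 0 closes; this file
discharges no binder by itself.

## References
* [Shimura1998] G. Shimura, *Abelian Varieties with Complex Multiplication and Modular Functions*, Princeton Univ. Press (1998):
  §21.4 Thm. 21.4 and its proof (p. 192); Prop. 19.10 with (19.10g) (pp. 136–137); Thm. 19.11 (proof) and Lemma 19.5 (p. 133); §18.6 Thm. 18.6.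
* [SerreTate1968] J.-P. Serre, J. Tate, *Good reduction of abelian varieties*, Ann. of Math. 88 (1968), §1: definition of good reduction
  (p. 492), Thm. 1 and Lemma 2; §7 Thm. 10–12.
* [BLRNeronModels1990] S. Bosch, W. Lütkebohmert, M. Raynaud, *Néron Models* (1990), §1.2 Prop. 8 and §4.4 Thm. 1 (the bridge r₀ — NOT used).
* [Milne1986AbelianVarieties] J. S. Milne, *Abelian Varieties* (1986), §20 Rem. 20.9 (spreading out an abelian variety with its group law).
-/

set_option autoImplicit false

open IsDedekindDomain IsDedekindDomain.HeightOneSpectrum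
open NumberField hiding ideleGroup
open scoped NumberField

namespace Summit.HodgeConjecture.CorCM.Hyp21

open Literature.AlgebraicGeometry.Motives
open Literature.NumberTheory.GaloisRepresentations
open Literature.NumberTheory.ComplexMultiplication
open Literature.NumberTheory.DiophantineGeometry (IsAbelianSchemeModel hasGoodReductionAt_of_exists_isAbelianSchemeModel)
open CategoryTheory
open scoped ComplexConjugate nonZeroDivisors

/-- **Shimura 1998 Thm. 21.4 (Casselman), FLAT reading, Frobenius clause keyed on SERRE–TATE good reduction — PROVED from the named fact
`shimura1998_thm18_6` (row II-1) ALONE.**  Under the hypotheses of the binder `shimura1998_thm21_4_casselman` (`k ⊇ K*`, (19.10a), (19.10b))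
there is a structure `(A₀, ι₀)` of type `(K, Φ)` over `k` and the family `(χ_τ)` of Prop. 19.10 with `χ_{τ₀} = χ` and, at every place `v`
where `A₀` has an abelian-scheme model over `𝓞_{k,v}` ([SerreTate1968] §1), the Frobenius element `π ∈ 𝓞_K` with `χ_τ(ϖ_v) = τ(π)` and
«Frobenius acts on `T_ℓ A₀` as `ι₀(π)`».  Shimura p. 192, last paragraph, as in A-p01's `thm21_4_casselman_of_facts` / B-p14's
`casselmanFlat_of_thm18_6_of_inertia`: `(A₀, ι₀)` from the Casselman core, `(χ_τ)` from `shimuraTaniyama_heckeCharactersST_of_thm18_6`; at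
the cofinitely many places with an abelian-scheme model (`exists_finite_forall_exists_isAbelianSchemeModel`) and unramified for `χ`,
`ι₀ π = ι₀ π'` on `T_ℓ A₀` forces `π = π'`, hence `χ_{τ₀} = χ` (`HeckeCharacter.ext_of_eventually_valueAtUniformizer_eq`).  No `h₁₂`, no
`h₃`, no r₀. [cite: Shimura1998, §21.4 Thm. 21.4 (proof, p. 192); Prop. 19.10, (19.10g); Thm. 19.11 (proof) with Lemma 19.5; §18.6 Thm. 18.6]
[cite: SerreTate1968, §1 (definition), Thm. 1; §7 Thm. 10–12] -/
theorem casselmanST_of_thm18_6 (h186 : shimura1998_thm18_6) :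
    ∀ (k : Type) [Field k] [NumberField k] [Algebra k ℂ] (K : Type) [Field K] [NumberField K]
      [IsCMField K] (Φ : CMType K) (τ₀ : K →+* ℂ) (χ : HeckeCharacter k),
    ((traceField Φ : Set ℂ) ⊆ Set.range (algebraMap k ℂ)) →
    χ.HasInfinityType (cmInfinityType Φ.1 τ₀ (algebraMap k ℂ)).1
      (cmInfinityType Φ.1 τ₀ (algebraMap k ℂ)).2 →
    (∀ x : ideleGroup k, (x : AdeleRing (𝓞 k) k).1 = 1 →
      (∃ b : K, ((χ x : ℂˣ) : ℂ) = τ₀ b) ∧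
        ((χ x : ℂˣ) : ℂ) * conj ((χ x : ℂˣ) : ℂ) = (((ideleNorm x)⁻¹ : ℝ) : ℂ)) →
    (∀ (v : HeightOneSpectrum (𝓞 k)) (u : (v.adicCompletionIntegers k)ˣ),
      ∃ b : (𝓞 K)ˣ, ((χ.localComponent v
        (Units.map ((v.adicCompletionIntegers k).subtype : _ →* _) u) : ℂˣ) : ℂ) =
        τ₀ ((b : 𝓞 K) : K)) →
    (∀ v : HeightOneSpectrum (𝓞 k), ∃ π : 𝓞 K, χ.valueAtUniformizer v = τ₀ (π : K) ∧
      ∀ (L : Type) [Field L] [NumberField L] [Normal ℚ L] (ιL : L →+* ℂ) (j : K →+* L)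
        (σL : k →+* L), ιL.comp σL = algebraMap k ℂ →
        IsReflexTypeNorm (valuedIn ιL Φ.1) j σL v.asIdeal (Ideal.span {π})) →
    ∃ (A₀ : AbelianVariety k) (ι₀ : 𝓞 K →+* End A₀), IsCMTypeRealisationOver Φ A₀ ι₀ ∧
      ∃ χfam : (K →+* ℂ) → HeckeCharacter k, χfam τ₀ = χ ∧
        ∀ v : HeightOneSpectrum (𝓞 k),
          (∃ (𝒜 : SchemeOver (valuationSubringAtPrime k v)) (_ : GrpObj 𝒜), IsAbelianSchemeModel A₀ v 𝒜) →
          ∃ π : 𝓞 K,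
            (∀ τ : K →+* ℂ, (χfam τ).valueAtUniformizer v = τ (π : K)) ∧
            (∀ (ℓ : ℕ) [Fact ℓ.Prime], (ℓ : 𝓞 k) ∉ v.asIdeal →
              ∀ 𝔓 ∈ v.primesAbove, ∀ σ : Field.absoluteGaloisGroup k, IsArithFrobAt (𝓞 k) σ 𝔓 →
                A₀.tateRep ℓ σ = AbelianVariety.tateModuleMap ℓ (ι₀ π : A₀ ⟶ A₀)) := by
  have hcore := casselmanCore_of_thm18_6 h186
  have hST := shimuraTaniyama_heckeCharactersST_of_thm18_6 h186
  intro k _ _ _ K _ _ _ Φ τ₀ χ hK ha hb hu hπ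
  obtain ⟨A₀, ι₀, hreal, hfrob⟩ := hcore k K Φ τ₀ χ hK ha hb hu hπ
  obtain ⟨χfam, -, -, -, -, h5⟩ := hST k K Φ A₀ ι₀ hreal
  have hιinj : Function.Injective ι₀ := injective_of_isCMTypeRealisationOver hreal
  -- cofinitely many abelian-scheme places (spreading out the group law — no r₀)
  have hgood : ∀ᶠ v : HeightOneSpectrum (𝓞 k) in Filter.cofinite,
      ∃ (𝒜 : SchemeOver (valuationSubringAtPrime k v)) (_ : GrpObj 𝒜), IsAbelianSchemeModel A₀ v 𝒜 := by
    obtain ⟨S, hS, hout⟩ := AbelianVariety.exists_finite_forall_exists_isAbelianSchemeModel A₀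
    exact Filter.eventually_cofinite.2 (hS.subset fun v hv => by
      by_contra hvS
      exact hv (hout v hvS))
  -- cofinitely many unramified places
  have hunr : ∀ᶠ v in Filter.cofinite, χ.IsUnramifiedAt v :=
    (χ.finite_ramifiedPlaces_iff).1 (HeckeCharacter.finite_ramifiedPlaces_holds χ)
  -- the two Frobenius descriptions agree there
  have hev : ∀ᶠ v in Filter.cofinite, (χfam τ₀).valueAtUniformizer v = χ.valueAtUniformizer v := by
    refine (hgood.and hunr).mono fun v hv => ?_
    obtain ⟨hv1, hv2⟩ := hv
    obtain ⟨π, hπval, hπfrob, -⟩ := h5 v hv1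
    obtain ⟨π', hπ'val, hπ'frob⟩ := hfrob v hv2
    obtain ⟨ℓ, hℓprime, hℓv⟩ := exists_prime_natCast_notMem v
    haveI : Fact ℓ.Prime := ⟨hℓprime⟩
    obtain ⟨𝔓, h𝔓⟩ := v.primesAbove_nonempty
    obtain ⟨σ, hσ⟩ :=
      IsDedekindDomain.HeightOneSpectrum.exists_isArithFrobAt_of_mem_primesAbove_holds (K := k) (v := v) h𝔓
    have e1 := hπfrob ℓ hℓv 𝔓 h𝔓 σ hσ
    have e2 := hπ'frob ℓ hℓv 𝔓 h𝔓 σ hσ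
    have hℓk : (ℓ : k) ≠ 0 := Nat.cast_ne_zero.2 hℓprime.ne_zero
    have hιeq : (ι₀ π : A₀ ⟶ A₀) = ι₀ π' :=
      AbelianVariety.hom_ext_of_tateModuleMap_eq ℓ hℓk (e1.symm.trans e2)
    have hππ' : π = π' := hιinj hιeq
    rw [hπval τ₀, hπ'val, hππ']
  have heq : χfam τ₀ = χ := HeckeCharacter.ext_of_eventually_valueAtUniformizer_eq hev
  refine ⟨A₀, ι₀, hreal, χfam, heq, fun v hv => ?_⟩
  obtain ⟨π, hπa, hπb, -⟩ := h5 v hv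
  exact ⟨π, hπa, hπb⟩

/-- **The Serre–Tate-keyed binder body ⇐ {S7a `levelStructure`, S5b `exists_balancedDivisor_finiteExtension`} and NOTHING ELSE** — the
level-structure reading of the floor (`thm18_6_of_levelStructure h7a h5b`, then `casselmanST_of_thm18_6`): the `h21` leg of the floor WITHOUT
the bridge r₀.  HC_CM is proved only modulo the 7 printed citations until rung 0 closes; the binder's `def` is not re-keyed here.
[cite: Shimura1998, §21.4 Thm. 21.4; §18.6 Thm. 18.6; Prop. 19.10] [cite: SerreTate1968, §1 (definition), Thm. 1; §7 Thm. 10–12] -/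
theorem casselmanST_of_levelStructure (h7a : levelStructure) (h5b : exists_balancedDivisor_finiteExtension) :
    ∀ (k : Type) [Field k] [NumberField k] [Algebra k ℂ] (K : Type) [Field K] [NumberField K]
      [IsCMField K] (Φ : CMType K) (τ₀ : K →+* ℂ) (χ : HeckeCharacter k),
    ((traceField Φ : Set ℂ) ⊆ Set.range (algebraMap k ℂ)) →
    χ.HasInfinityType (cmInfinityType Φ.1 τ₀ (algebraMap k ℂ)).1
      (cmInfinityType Φ.1 τ₀ (algebraMap k ℂ)).2 →
    (∀ x : ideleGroup k, (x : AdeleRing (𝓞 k) k).1 = 1 →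
      (∃ b : K, ((χ x : ℂˣ) : ℂ) = τ₀ b) ∧
        ((χ x : ℂˣ) : ℂ) * conj ((χ x : ℂˣ) : ℂ) = (((ideleNorm x)⁻¹ : ℝ) : ℂ)) →
    (∀ (v : HeightOneSpectrum (𝓞 k)) (u : (v.adicCompletionIntegers k)ˣ),
      ∃ b : (𝓞 K)ˣ, ((χ.localComponent v
        (Units.map ((v.adicCompletionIntegers k).subtype : _ →* _) u) : ℂˣ) : ℂ) =
        τ₀ ((b : 𝓞 K) : K)) →
    (∀ v : HeightOneSpectrum (𝓞 k), ∃ π : 𝓞 K, χ.valueAtUniformizer v = τ₀ (π : K) ∧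
      ∀ (L : Type) [Field L] [NumberField L] [Normal ℚ L] (ιL : L →+* ℂ) (j : K →+* L)
        (σL : k →+* L), ιL.comp σL = algebraMap k ℂ →
        IsReflexTypeNorm (valuedIn ιL Φ.1) j σL v.asIdeal (Ideal.span {π})) →
    ∃ (A₀ : AbelianVariety k) (ι₀ : 𝓞 K →+* End A₀), IsCMTypeRealisationOver Φ A₀ ι₀ ∧
      ∃ χfam : (K →+* ℂ) → HeckeCharacter k, χfam τ₀ = χ ∧
        ∀ v : HeightOneSpectrum (𝓞 k),
          (∃ (𝒜 : SchemeOver (valuationSubringAtPrime k v)) (_ : GrpObj 𝒜), IsAbelianSchemeModel A₀ v 𝒜) →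
          ∃ π : 𝓞 K,
            (∀ τ : K →+* ℂ, (χfam τ).valueAtUniformizer v = τ (π : K)) ∧
            (∀ (ℓ : ℕ) [Fact ℓ.Prime], (ℓ : 𝓞 k) ∉ v.asIdeal →
              ∀ 𝔓 ∈ v.primesAbove, ∀ σ : Field.absoluteGaloisGroup k, IsArithFrobAt (𝓞 k) σ 𝔓 →
                A₀.tateRep ℓ σ = AbelianVariety.tateModuleMap ℓ (ι₀ π : A₀ ⟶ A₀)) :=
  casselmanST_of_thm18_6 (thm18_6_of_levelStructure h7a h5b)

/-- **Sanity bridge (the Serre–Tate re-keying is a WEAKENING of the ♭ binder body)**: the ♭ body with its scheme-level antecedent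
`HasGoodReductionAt A₀.X A₀.dim v` — the place-free restatement `casselmanFlat_of_casselman h21` of the binder's own projection — implies
the Serre–Tate-keyed body, since an abelian-scheme model is a smooth proper model of the variety
(`hasGoodReductionAt_of_exists_isAbelianSchemeModel`).  The converse direction is exactly the bridge r₀.
[cite: Shimura1998, §21.4 Thm. 21.4] [cite: SerreTate1968, §1 (definition of good reduction)] -/
theorem casselmanST_of_casselmanFlat
    (hflat : ∀ (k : Type) [Field k] [NumberField k] [Algebra k ℂ] (K : Type) [Field K] [NumberField K]
      [IsCMField K] (Φ : CMType K) (τ₀ : K →+* ℂ) (χ : HeckeCharacter k),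
    ((traceField Φ : Set ℂ) ⊆ Set.range (algebraMap k ℂ)) →
    χ.HasInfinityType (cmInfinityType Φ.1 τ₀ (algebraMap k ℂ)).1
      (cmInfinityType Φ.1 τ₀ (algebraMap k ℂ)).2 →
    (∀ x : ideleGroup k, (x : AdeleRing (𝓞 k) k).1 = 1 →
      (∃ b : K, ((χ x : ℂˣ) : ℂ) = τ₀ b) ∧
        ((χ x : ℂˣ) : ℂ) * conj ((χ x : ℂˣ) : ℂ) = (((ideleNorm x)⁻¹ : ℝ) : ℂ)) →
    (∀ (v : HeightOneSpectrum (𝓞 k)) (u : (v.adicCompletionIntegers k)ˣ),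
      ∃ b : (𝓞 K)ˣ, ((χ.localComponent v
        (Units.map ((v.adicCompletionIntegers k).subtype : _ →* _) u) : ℂˣ) : ℂ) =
        τ₀ ((b : 𝓞 K) : K)) →
    (∀ v : HeightOneSpectrum (𝓞 k), ∃ π : 𝓞 K, χ.valueAtUniformizer v = τ₀ (π : K) ∧
      ∀ (L : Type) [Field L] [NumberField L] [Normal ℚ L] (ιL : L →+* ℂ) (j : K →+* L)
        (σL : k →+* L), ιL.comp σL = algebraMap k ℂ →
        IsReflexTypeNorm (valuedIn ιL Φ.1) j σL v.asIdeal (Ideal.span {π})) →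
    ∃ (A₀ : AbelianVariety k) (ι₀ : 𝓞 K →+* End A₀), IsCMTypeRealisationOver Φ A₀ ι₀ ∧
      ∃ χfam : (K →+* ℂ) → HeckeCharacter k, χfam τ₀ = χ ∧
        ∀ v : HeightOneSpectrum (𝓞 k), HasGoodReductionAt A₀.X A₀.dim v →
          ∃ π : 𝓞 K,
            (∀ τ : K →+* ℂ, (χfam τ).valueAtUniformizer v = τ (π : K)) ∧
            (∀ (ℓ : ℕ) [Fact ℓ.Prime], (ℓ : 𝓞 k) ∉ v.asIdeal →
              ∀ 𝔓 ∈ v.primesAbove, ∀ σ : Field.absoluteGaloisGroup k, IsArithFrobAt (𝓞 k) σ 𝔓 →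
                A₀.tateRep ℓ σ = AbelianVariety.tateModuleMap ℓ (ι₀ π : A₀ ⟶ A₀))) :
    ∀ (k : Type) [Field k] [NumberField k] [Algebra k ℂ] (K : Type) [Field K] [NumberField K]
      [IsCMField K] (Φ : CMType K) (τ₀ : K →+* ℂ) (χ : HeckeCharacter k),
    ((traceField Φ : Set ℂ) ⊆ Set.range (algebraMap k ℂ)) →
    χ.HasInfinityType (cmInfinityType Φ.1 τ₀ (algebraMap k ℂ)).1
      (cmInfinityType Φ.1 τ₀ (algebraMap k ℂ)).2 →
    (∀ x : ideleGroup k, (x : AdeleRing (𝓞 k) k).1 = 1 →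
      (∃ b : K, ((χ x : ℂˣ) : ℂ) = τ₀ b) ∧
        ((χ x : ℂˣ) : ℂ) * conj ((χ x : ℂˣ) : ℂ) = (((ideleNorm x)⁻¹ : ℝ) : ℂ)) →
    (∀ (v : HeightOneSpectrum (𝓞 k)) (u : (v.adicCompletionIntegers k)ˣ),
      ∃ b : (𝓞 K)ˣ, ((χ.localComponent v
        (Units.map ((v.adicCompletionIntegers k).subtype : _ →* _) u) : ℂˣ) : ℂ) =
        τ₀ ((b : 𝓞 K) : K)) →
    (∀ v : HeightOneSpectrum (𝓞 k), ∃ π : 𝓞 K, χ.valueAtUniformizer v = τ₀ (π : K) ∧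
      ∀ (L : Type) [Field L] [NumberField L] [Normal ℚ L] (ιL : L →+* ℂ) (j : K →+* L)
        (σL : k →+* L), ιL.comp σL = algebraMap k ℂ →
        IsReflexTypeNorm (valuedIn ιL Φ.1) j σL v.asIdeal (Ideal.span {π})) →
    ∃ (A₀ : AbelianVariety k) (ι₀ : 𝓞 K →+* End A₀), IsCMTypeRealisationOver Φ A₀ ι₀ ∧
      ∃ χfam : (K →+* ℂ) → HeckeCharacter k, χfam τ₀ = χ ∧
        ∀ v : HeightOneSpectrum (𝓞 k),
          (∃ (𝒜 : SchemeOver (valuationSubringAtPrime k v)) (_ : GrpObj 𝒜), IsAbelianSchemeModel A₀ v 𝒜) →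
          ∃ π : 𝓞 K,
            (∀ τ : K →+* ℂ, (χfam τ).valueAtUniformizer v = τ (π : K)) ∧
            (∀ (ℓ : ℕ) [Fact ℓ.Prime], (ℓ : 𝓞 k) ∉ v.asIdeal →
              ∀ 𝔓 ∈ v.primesAbove, ∀ σ : Field.absoluteGaloisGroup k, IsArithFrobAt (𝓞 k) σ 𝔓 →
                A₀.tateRep ℓ σ = AbelianVariety.tateModuleMap ℓ (ι₀ π : A₀ ⟶ A₀)) := by
  intro k _ _ _ K _ _ _ Φ τ₀ χ hK ha hb hu hπ
  obtain ⟨A₀, ι₀, hreal, χfam, heq, h5⟩ := hflat k K Φ τ₀ χ hK ha hb hu hπ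
  exact ⟨A₀, ι₀, hreal, χfam, heq, fun v hv => h5 v (hasGoodReductionAt_of_exists_isAbelianSchemeModel hv)⟩

end Summit.HodgeConjecture.CorCM.Hyp21
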